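import Literature.NumberTheory.LFunctions.BurnolCoPoissonSubspace
import Literature.NumberTheory.LFunctions.BurnolFourierZetaSonine
import Literature.NumberTheory.LFunctions.BurnolEvaluatorProofs
import Literature.NumberTheory.LFunctions.BurnolEvaluatorsMinimal
import Literature.NumberTheory.LFunctions.BurnolZetaSystemsProofs
import HarnessLib

/-!
# Co-Poisson Sonine vectors are orthogonal to the zeta evaluators: the `Z^a_{ρ,k}` (resp.
# `Y^a_{ρ,k}`) are not complete in `K_a` (resp. `L_a`) for `a < 1`

LINE 1 — LABEL: RH-FREE (`L²`/Mellin harmonic analysis on `(0,∞)`; `ζ` enters as the Mellin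
multiplier of the co-Poisson summation and through the NAMES of its non-trivial zeros, wherever they
lie). FRAMING (cell rh-crit, D-0074): corpus theorems are RH-FREE literature; nothing in this module is
worded as progress toward RH. bears_on: B-C/B-P (LADDER-RH COLUMN 6, de Branges framework). WHAT THIS
IS NOT: not a route, not a criterion for RH, no positivity condition at `E_ζ` is asserted (Conrey–Li
guard); which evaluators fail to span `K_a` does not move RH. Nothing here bears on the truth of RH.

Source: J.-F. Burnol, *Two complete and minimal systems associated with the zeros of the Riemann zeta
function*, J. Théor. Nombres Bordeaux 16 (2004) 65–94 = arXiv:math/0203120v7 [Burnol2004b] (TeX of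
record `dbl/src/Burnol2004JTNB_arXivmath0203120v7.tex`). This module PROVES (no new definitions, no new
named facts):

* eq. (12) of §2 (TeX l.341–347) for Sonine test functions: for `α` smooth, even, compactly supported
  away from `0` with `∫₀^∞ α(u)du/u = 0`, the right Mellin transform of the co-Poisson sum
  `P'(α)(t) = Σ_{n≥1} α(t/n)/n − ∫₀^∞ α(u)du/u` is `ζ(s)·α̂(s)` — for `Re s > 1` by termwise
  integration (`IsTestAway.rightMellin_coSum_eq_of_one_lt_re`), and then for every `s ≠ 1` since both
  sides are holomorphic off `s = 1` (`P'(α)` is a Schwartz function vanishing near `0`, so its Mellin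
  transform is entire; `IsTestAway.rightMellin_coSum_eq`);
* hence, for the `L²` class `F` of `P'(α)` (an element of `W'_a = P_a ∩ K_a` when also `∫₀^∞ α = 0`
  and `supp α ⊂ [a, 1/a]`, TeX l.500–512), the continued transform `G_F = ζ·α̂` off `s = 1`
  (`rightMellinExt_toLp_coSum`) and the evaluations `M(F)^{(k)}(ρ) = 0` at every non-trivial zero
  `ρ`, `0 ≤ k < m_ρ` (`burnolEval_toLp_coSum_eq_zero`);
* hence `F ⊥ Z` for every vector `Z` representing such an evaluation on `K_a` (`IsBurnolZ`) or on
  `L_a` (`IsBurnolY`) (`inner_toLp_coSum_eq_zero_of_isBurnolZ`, `…_of_isBurnolY`), and, `F ≠ 0`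
  being available for `a < 1` (three-bump test functions with two vanishing moments),
  the NON-COMPLETENESS clauses of Thm. 3.2 ("The vectors `Z^a_{ρ,k}`, `0 ≤ k < m_ρ`, are a minimal,
  but not complete, system for `a < 1`", TeX l.528–530) and of Prop. 6.4 ("The vectors `Y^a_{ρ,k}`
  are minimal and not complete in `L_a`" — "not complete from the existence of the co-Poisson
  subspace `P_a`", TeX l.1282–1291), stated for ANY system of representing vectors
  (`not_isCompleteSystemIn_sonineK_of_isBurnolZ`, `not_isCompleteSystemIn_sonineL_of_isBurnolY`):
  and then for the tree's `ε`-chosen systems `burnolZSystem a` / `burnolYSystem a` (whose members ARE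
  representing vectors: `BurnolEvaluators.isBurnolZ_burnolZSystem`, `BurnolEvaluators.isBurnolY_burnolYSystem`
  of `BurnolEvaluatorProofs.lean` / `BurnolSonineEvaluators.lean`):
  `not_isCompleteSystemIn_sonineK_burnolZSystem` IS the inline hypothesis `hnc` of the tree's assembly
  `Literature.NumberTheory.LFunctions.Burnol2004b_thm3_2_of` (so that Thm. 3.2 now follows from the
  named facts Thm. 6.7, Props. 6.5, 6.6 alone: `Burnol2004b_thm3_2_of_constituents`), and
  `not_isCompleteSystemIn_sonineL_burnolYSystem` is the second half of
  `Literature.NumberTheory.LFunctions.Burnol2004b_prop6_4`; with the minimality half already a tree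
  theorem (`BurnolEvaluatorsMinimal.Burnol2004b_prop6_4_minimal`, the dual functionals of Thm. 6.3)
  this DISCHARGES Prop. 6.4: **`Burnol2004b_prop6_4_holds : Burnol2004b_prop6_4`**.

Tree inputs cited, not restated: `CoPoisson.coSum`, `CoPoisson.IsTestAway` and the Part-1 theorems of
[Burnol2004] (`BurnolFourierZeta*.lean`: `IsTestAway.memLp_two_coSum`, `IsTestAway.exists_schwartzMap_coe_eq`,
`CoPoisson.IsTestAway.toLp_coSum_mem_sonineK`, …), the §2 vocabulary of `BurnolZetaSystems.lean`
(`sonineK`, `sonineL`, `rightMellin`, `rightMellinExt`, `burnolEval`, `IsBurnolZ`, `IsBurnolY`,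
`IsCompleteSystemIn`, `ZetaZeroIndex`) and `ZetaZeros.lean` (`riemannZetaZeroOrder`,
`ZetaZeros.riemannZetaNontrivialZeros`).

## References
* [Burnol2004b] §2 eq. (12)–(13) (arXiv:math/0203120v7 p. 4, TeX l.327–347), §2 Definitions and the
  remark `W'_a = P_a ∩ K_a` (p. 5, TeX l.486–512), Thm. 3.2 (p. 6, TeX l.528–539), Prop. 6.4 (p. 16,
  TeX l.1282–1291).
* [Burnol2004] J.-F. Burnol, *On Fourier and Zeta(s)*, Forum Math. 16 (2004) 789–840, Thm 3.9 and §6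
  (TeX l.2190–2203) — the co-Poisson construction of Sonine functions (tree `BurnolFourierZeta*.lean`).
-/

noncomputable section

open MeasureTheory Complex Filter Set Asymptotics
open scoped Topology Real ENNReal ComplexConjugate FourierTransform

namespace Literature.NumberTheory.LFunctions

namespace CoPoisson

variable {α : ℝ → ℂ}

/-! ## A. Test functions: vanishing near `0` and at infinity, conjugation -/

namespace IsTestAway

/-- A test function away from the origin vanishes on a neighbourhood of `0`.
[cite: Burnol2004, Thm 4.4 (TeX l. 1288), "compact support away from the origin"] -/
theorem eventuallyEq_zero_nhds_zero (h : IsTestAway α) : α =ᶠ[𝓝 (0 : ℝ)] 0 :=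
  notMem_tsupport_iff_eventuallyEq.1 h.zero_notMem_tsupport

/-- A test function away from the origin vanishes for all large arguments.
[cite: Burnol2004, Thm 4.4 (TeX l. 1288), "compact support"] -/
theorem eventuallyEq_zero_atTop (h : IsTestAway α) : α =ᶠ[atTop] 0 := by
  obtain ⟨R, hR⟩ := (h.hasCompactSupport.isCompact.isBounded).subset_closedBall 0
  filter_upwards [eventually_gt_atTop R] with y hy
  apply image_eq_zero_of_notMem_tsupport
  intro hmem
  have := hR hmem
  rw [Metric.mem_closedBall, dist_zero_right, Real.norm_eq_abs] at this
  linarith [le_abs_self y]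

/-- The complex conjugate of a test function away from the origin is again one.
[cite: Burnol2004, Thm 4.4 (TeX l. 1288)] -/
theorem comp_conj (h : IsTestAway α) : IsTestAway (fun y ↦ conj (α y)) := by
  refine ⟨?_, fun y ↦ by simp [h.even y], ?_, ?_⟩
  · exact Complex.conjCLE.contDiff.comp h.contDiff
  · exact h.hasCompactSupport.comp_left (map_zero _)
  · intro hmem
    apply h.zero_notMem_tsupport
    exact tsupport_comp_subset (map_zero _) _ hmem

end IsTestAway

/-- Conjugation commutes with the co-Poisson summation: `P'(ᾱ)(y) = conj (P'(α)(y))`.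
[cite: Burnol2004, Thm 4.4 (TeX l. 1287–1296)] -/
theorem coSum_conj (α : ℝ → ℂ) (y : ℝ) :
    coSum (fun u ↦ conj (α u)) y = conj (coSum α y) := by
  simp only [coSum, map_sub, Complex.conj_tsum, map_div₀, ← integral_conj, Complex.conj_ofReal,
    map_add, map_natCast, map_one]

/-! ## B. Right Mellin transforms: `α̂` and `P'(α)^` are entire; eq. (12) -/

namespace IsTestAway

/-- The (left) Mellin transform of a test function away from the origin is differentiable
everywhere (an entire function). [cite: Burnol2004b, §6 proof of Thm. 6.7 (arXiv:math/0203120v7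
p. 17, TeX l.1346–1349), "Its right Mellin transform `θ̂(s)` is then `O(A^{|Re(s)|})` on `ℂ`"] -/
theorem differentiableAt_mellin (h : IsTestAway α) (s : ℂ) : DifferentiableAt ℂ (mellin α) s := by
  refine mellin_differentiableAt_of_isBigO_rpow (a := s.re + 1) (b := s.re - 1)
    (h.contDiff.continuous.continuousOn.locallyIntegrableOn measurableSet_Ioi) ?_ (by linarith) ?_
    (by linarith)
  · exact (isBigO_zero _ _).congr' h.eventuallyEq_zero_atTop.symm EventuallyEq.rfl
  · have h0 : α =ᶠ[𝓝[>] (0 : ℝ)] 0 := nhdsWithin_le_nhds h.eventuallyEq_zero_nhds_zero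
    exact (isBigO_zero _ _).congr' h0.symm EventuallyEq.rfl

/-- The Mellin transform of a test function away from the origin converges absolutely at every `s`.
[cite: Burnol2004b, §6 proof of Thm. 6.7 (arXiv:math/0203120v7 p. 17, TeX l.1346–1349)] -/
theorem mellinConvergent (h : IsTestAway α) (s : ℂ) : MellinConvergent α s := by
  refine mellinConvergent_of_isBigO_rpow (a := s.re + 1) (b := s.re - 1)
    (h.contDiff.continuous.continuousOn.locallyIntegrableOn measurableSet_Ioi) ?_ (by linarith) ?_
    (by linarith)
  · exact (isBigO_zero _ _).congr' h.eventuallyEq_zero_atTop.symm EventuallyEq.rfl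
  · have h0 : α =ᶠ[𝓝[>] (0 : ℝ)] 0 := nhdsWithin_le_nhds h.eventuallyEq_zero_nhds_zero
    exact (isBigO_zero _ _).congr' h0.symm EventuallyEq.rfl

/-- The right Mellin transform `α̂(s) = ∫₀^∞ α(t)t^{−s}dt` of a test function is entire.
[cite: Burnol2004b, §6 proof of Thm. 6.7 (arXiv:math/0203120v7 p. 17, TeX l.1346–1349)] -/
theorem differentiable_rightMellin (h : IsTestAway α) : Differentiable ℂ (rightMellin α) :=
  fun s ↦ (h.differentiableAt_mellin (1 - s)).comp s ((differentiableAt_const _).sub differentiableAt_id)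

/-- With `∫₀^∞ α(u)du/u = 0` the co-Poisson sum `P'(α)` vanishes on a neighbourhood of `0`
(Thm 3.8: near the origin it is the constant `−∫₀^∞ α(u)du/u`).
[cite: Burnol2004, Thm 3.8 (TeX l. 1043); Burnol2004b, §2 (arXiv:math/0203120v7 p. 5, TeX l.404–411)] -/
theorem coSum_eventuallyEq_zero (h : IsTestAway α) (h1 : ∫ u in Ioi (0 : ℝ), α u / (u : ℂ) = 0) :
    coSum α =ᶠ[𝓝 (0 : ℝ)] 0 := by
  filter_upwards [h.coSum_eventually_eq] with y hy
  rw [hy, h1, neg_zero, Pi.zero_apply]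

/-- `P'(α)` decays faster than any power at infinity (it is a Schwartz function, Thm 3.9).
[cite: Burnol2004, Thm 3.9 (TeX l. 1137)] -/
theorem coSum_isBigO_rpow_atTop (h : IsTestAway α) (N : ℝ) :
    coSum α =O[atTop] fun t : ℝ ↦ t ^ (-N) := by
  obtain ⟨φ, hφ⟩ := h.exists_schwartzMap_coe_eq
  obtain ⟨k, hk⟩ : ∃ k : ℕ, N ≤ k := exists_nat_ge N
  obtain ⟨C, hC0, hC⟩ := φ.decay k 0
  refine IsBigO.of_bound C ?_
  filter_upwards [eventually_ge_atTop (1 : ℝ)] with t ht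
  have ht0 : 0 < t := by linarith
  have hφt : ‖φ t‖ = ‖coSum α t‖ := by rw [← hφ]
  have h1 := hC t
  rw [norm_iteratedFDeriv_zero, Real.norm_eq_abs, abs_of_pos ht0, hφt] at h1
  have htk : 0 < t ^ k := by positivity
  rw [Real.norm_of_nonneg (Real.rpow_nonneg ht0.le _), Real.rpow_neg ht0.le]
  have hkN : t ^ N ≤ t ^ (k : ℝ) := Real.rpow_le_rpow_of_exponent_le ht hk
  rw [Real.rpow_natCast] at hkN
  have hN0 : 0 < t ^ N := Real.rpow_pos_of_pos ht0 N
  calc ‖coSum α t‖ = (t ^ k * ‖coSum α t‖) * (t ^ k)⁻¹ := by field_simp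
    _ ≤ C * (t ^ k)⁻¹ := by gcongr
    _ ≤ C * (t ^ N)⁻¹ := by gcongr

/-- With `∫₀^∞ α(u)du/u = 0`, the Mellin transform of `P'(α)` converges absolutely at every `s`.
[cite: Burnol2004b, §2 eq. (12) (arXiv:math/0203120v7 p. 4, TeX l.341–347)] -/
theorem mellinConvergent_coSum (h : IsTestAway α) (h1 : ∫ u in Ioi (0 : ℝ), α u / (u : ℂ) = 0)
    (s : ℂ) : MellinConvergent (coSum α) s := by
  refine mellinConvergent_of_isBigO_rpow (a := s.re + 1) (b := s.re - 1)
    (h.continuous_coSum.continuousOn.locallyIntegrableOn measurableSet_Ioi)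
    (h.coSum_isBigO_rpow_atTop _) (by linarith) ?_ (by linarith)
  have h0 : coSum α =ᶠ[𝓝[>] (0 : ℝ)] 0 := nhdsWithin_le_nhds (h.coSum_eventuallyEq_zero h1)
  exact (isBigO_zero _ _).congr' h0.symm EventuallyEq.rfl

/-- With `∫₀^∞ α(u)du/u = 0`, the Mellin transform of `P'(α)` is differentiable at every `s`.
[cite: Burnol2004b, §2 eq. (12) (arXiv:math/0203120v7 p. 4, TeX l.341–347)] -/
theorem differentiableAt_mellin_coSum (h : IsTestAway α)
    (h1 : ∫ u in Ioi (0 : ℝ), α u / (u : ℂ) = 0) (s : ℂ) :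
    DifferentiableAt ℂ (mellin (coSum α)) s := by
  refine mellin_differentiableAt_of_isBigO_rpow (a := s.re + 1) (b := s.re - 1)
    (h.continuous_coSum.continuousOn.locallyIntegrableOn measurableSet_Ioi)
    (h.coSum_isBigO_rpow_atTop _) (by linarith) ?_ (by linarith)
  have h0 : coSum α =ᶠ[𝓝[>] (0 : ℝ)] 0 := nhdsWithin_le_nhds (h.coSum_eventuallyEq_zero h1)
  exact (isBigO_zero _ _).congr' h0.symm EventuallyEq.rfl

/-- With `∫₀^∞ α(u)du/u = 0`, the right Mellin transform of `P'(α)` is an entire function.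
[cite: Burnol2004b, §2 eq. (12) (arXiv:math/0203120v7 p. 4, TeX l.341–347)] -/
theorem differentiable_rightMellin_coSum (h : IsTestAway α)
    (h1 : ∫ u in Ioi (0 : ℝ), α u / (u : ℂ) = 0) : Differentiable ℂ (rightMellin (coSum α)) :=
  fun s ↦ (h.differentiableAt_mellin_coSum h1 (1 - s)).comp s
    ((differentiableAt_const _).sub differentiableAt_id)

/-- For a positive real `x`: `x⁻¹ ^ (−(1 − s)) / x = 1 / x ^ s`. [folklore] -/
private theorem inv_cpow_neg_div {x : ℝ} (hx : 0 < x) (s : ℂ) :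
    ((x : ℂ)⁻¹) ^ (-(1 - s)) / (x : ℂ) = 1 / (x : ℂ) ^ s := by
  have hx0 : (x : ℂ) ≠ 0 := ofReal_ne_zero.2 hx.ne'
  have harg : (x : ℂ).arg ≠ π := by
    rw [arg_ofReal_of_nonneg hx.le]; exact Real.pi_ne_zero.symm
  rw [inv_cpow _ _ harg, cpow_neg, inv_inv, cpow_sub _ _ hx0, cpow_one]
  field_simp

/-- **Eq. (12) for `Re s > 1`** — termwise integration: with `∫₀^∞ α(u)du/u = 0`,
`∫₀^∞ P'(α)(t) t^{−s} dt = Σ_{n≥1} n^{−1}∫₀^∞ α(t/n) t^{−s} dt = Σ_{n≥1} n^{−s} α̂(s) = ζ(s)α̂(s)`.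
[cite: Burnol2004b, §2 eq. (12) (arXiv:math/0203120v7 p. 4, TeX l.341–347)] -/
theorem rightMellin_coSum_eq_of_one_lt_re (h : IsTestAway α)
    (h1 : ∫ u in Ioi (0 : ℝ), α u / (u : ℂ) = 0) {s : ℂ} (hs : 1 < s.re) :
    rightMellin (coSum α) s = riemannZeta s * rightMellin α s := by
  unfold rightMellin
  set w : ℂ := 1 - s with hw
  have hwre : w.re = 1 - s.re := by simp [hw]
  -- the pieces `F n t = t^{w-1} • (α(t/(n+1))/(n+1))`
  set F : ℕ → ℝ → ℂ := fun n t ↦ (t : ℂ) ^ (w - 1) • (α (t / ((n : ℝ) + 1)) / ((n : ℂ) + 1))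
    with hF
  have hconv : MellinConvergent α w := h.mellinConvergent w
  have hFeq : ∀ n : ℕ, F n = fun t : ℝ ↦
      ((n : ℂ) + 1)⁻¹ • ((t : ℂ) ^ (w - 1) • α ((((n : ℝ) + 1)⁻¹ : ℝ) * t)) := by
    intro n; funext t
    simp only [hF, smul_eq_mul, div_eq_inv_mul]
    ring
  have hFint : ∀ n, Integrable (F n) (volume.restrict (Ioi 0)) := by
    intro n
    have hn : (0 : ℝ) < ((n : ℝ) + 1)⁻¹ := by positivity
    have := ((MellinConvergent.comp_mul_left (f := α) (s := w) hn).2 hconv).smul ((n : ℂ) + 1)⁻¹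
    rw [hFeq n]
    exact this
  -- the real majorant `g(x) = x^{Re w - 1} ‖α x‖`
  set g : ℝ → ℝ := fun x ↦ x ^ (w.re - 1) * ‖α x‖ with hg
  have hgint : Integrable g (volume.restrict (Ioi 0)) := by
    have h1' : Integrable (fun t : ℝ ↦ ‖(t : ℂ) ^ (w - 1) • α t‖) (volume.restrict (Ioi 0)) :=
      hconv.norm
    refine h1'.congr ?_
    filter_upwards [ae_restrict_mem measurableSet_Ioi] with t (ht : 0 < t)
    simp only [hg, norm_smul, norm_cpow_eq_rpow_re_of_pos ht, sub_re, one_re]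
  have hFnorm : ∀ n : ℕ, ∫ t in Ioi (0 : ℝ), ‖F n t‖ =
      ((n : ℝ) + 1) ^ (-s.re) * ∫ x in Ioi (0 : ℝ), g x := by
    intro n
    have hn : (0 : ℝ) < (n : ℝ) + 1 := by positivity
    have hn' : (0 : ℝ) < ((n : ℝ) + 1)⁻¹ := by positivity
    have h1' : ∀ t ∈ Ioi (0 : ℝ), ‖F n t‖ =
        ((n : ℝ) + 1) ^ (w.re - 2) * g (((n : ℝ) + 1)⁻¹ * t) := by
      intro t ht
      have ht' : (0 : ℝ) < t := ht
      have hnc : ‖((n : ℂ) + 1)‖ = (n : ℝ) + 1 := by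
        rw [show ((n : ℂ) + 1) = (((n : ℝ) + 1 : ℝ) : ℂ) by push_cast; ring, norm_real,
          Real.norm_of_nonneg hn.le]
      simp only [hF, hg, norm_smul, norm_div, norm_cpow_eq_rpow_re_of_pos ht', sub_re, one_re, hnc]
      rw [div_eq_inv_mul t, Real.mul_rpow hn'.le ht'.le, Real.inv_rpow hn.le]
      have e1 : ((n : ℝ) + 1) ^ (w.re - 2) = ((n : ℝ) + 1) ^ (w.re - 1) * ((n : ℝ) + 1)⁻¹ := by
        rw [show w.re - 2 = (w.re - 1) + (-1) by ring, Real.rpow_add hn, Real.rpow_neg_one]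
      rw [e1]
      field_simp
    rw [setIntegral_congr_fun measurableSet_Ioi h1', integral_const_mul,
      integral_comp_mul_left_Ioi g 0 hn', mul_zero, smul_eq_mul, ← mul_assoc, inv_inv]
    congr 1
    rw [show w.re - 2 = -s.re + (-1) by rw [hwre]; ring, Real.rpow_add hn, Real.rpow_neg_one]
    field_simp
  have hsum : Summable fun n ↦ ∫ t in Ioi (0 : ℝ), ‖F n t‖ := by
    simp_rw [hFnorm]
    refine Summable.mul_right _ ?_
    have h' := (summable_nat_add_iff 1).2 (Real.summable_nat_rpow.2 (by linarith : -s.re < -1))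
    simpa [Nat.cast_add, Nat.cast_one] using h'
  -- interchange of sum and integral
  have hswap : ∫ t in Ioi (0 : ℝ), ∑' n, F n t = ∑' n, ∫ t in Ioi (0 : ℝ), F n t :=
    (integral_tsum_of_summable_integral_norm hFint hsum).symm
  -- termwise values
  have hterm : ∀ n : ℕ, ∫ t in Ioi (0 : ℝ), F n t = (1 / ((n : ℂ) + 1) ^ s) * mellin α w := by
    intro n
    have hn : (0 : ℝ) < ((n : ℝ) + 1)⁻¹ := by positivity
    have hmul := mellin_comp_mul_left α w hn
    rw [mellin] at hmul
    rw [hFeq n, integral_smul, hmul, smul_eq_mul, smul_eq_mul, ← mul_assoc]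
    congr 1
    have hx : (0 : ℝ) < (n : ℝ) + 1 := by positivity
    have e := inv_cpow_neg_div hx s
    rw [hw]
    push_cast at e ⊢
    rw [← e, div_eq_mul_inv, mul_comm]
  calc mellin (coSum α) w = ∫ t in Ioi (0 : ℝ), ∑' n, F n t := by
        rw [mellin]
        refine setIntegral_congr_fun measurableSet_Ioi fun t _ ↦ ?_
        simp only [hF, coSum, h1, sub_zero, smul_eq_mul]
        rw [tsum_mul_left]
    _ = ∑' n, ∫ t in Ioi (0 : ℝ), F n t := hswap
    _ = ∑' n : ℕ, (1 / ((n : ℂ) + 1) ^ s) * mellin α w := tsum_congr hterm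
    _ = riemannZeta s * mellin α w := by
        rw [tsum_mul_right, zeta_eq_tsum_one_div_nat_add_one_cpow hs]

/-- **Eq. (12) off `s = 1`** (analytic continuation): with `∫₀^∞ α(u)du/u = 0`, the entire function
`P'(α)^` and the function `ζ·α̂`, holomorphic on `ℂ ∖ {1}`, agree on `Re s > 1`, hence on `ℂ ∖ {1}`.
[cite: Burnol2004b, §2 eq. (12)–(13) (arXiv:math/0203120v7 p. 4, TeX l.341–347)] -/
theorem rightMellin_coSum_eq (h : IsTestAway α) (h1 : ∫ u in Ioi (0 : ℝ), α u / (u : ℂ) = 0)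
    {s : ℂ} (hs : s ≠ 1) : rightMellin (coSum α) s = riemannZeta s * rightMellin α s := by
  set U : Set ℂ := {z : ℂ | z ≠ 1} with hU
  have hUo : IsOpen U := isOpen_ne
  have hpre : IsPreconnected U :=
    (isConnected_compl_singleton_of_one_lt_rank (by simp) (1 : ℂ)).isPreconnected
  have hfan : AnalyticOnNhd ℂ (rightMellin (coSum α)) U :=
    (h.differentiable_rightMellin_coSum h1).differentiableOn.analyticOnNhd hUo
  have hgan : AnalyticOnNhd ℂ (fun z ↦ riemannZeta z * rightMellin α z) U := by
    refine DifferentiableOn.analyticOnNhd (fun z hz ↦ ?_) hUo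
    exact ((differentiableAt_riemannZeta hz).mul (h.differentiable_rightMellin z)).differentiableWithinAt
  have h2 : (2 : ℂ) ∈ U := by simp [hU]
  have hfg : rightMellin (coSum α) =ᶠ[𝓝 2] fun z ↦ riemannZeta z * rightMellin α z := by
    have : ∀ᶠ z in 𝓝 (2 : ℂ), 1 < z.re :=
      (continuous_re.isOpen_preimage _ isOpen_Ioi).mem_nhds (by simp)
    filter_upwards [this] with z hz
    exact h.rightMellin_coSum_eq_of_one_lt_re h1 hz
  exact hfan.eqOn_of_preconnected_of_eventuallyEq hgan hpre h2 hfg hs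

end IsTestAway

end CoPoisson

open CoPoisson

/-! ## C. The `L²` class of `P'(α)`: its continued right Mellin transform is `ζ·α̂` -/

section SonineVector

variable {α : ℝ → ℂ}

/-- The right Mellin transform of the `L²` class of `P'(α)` is that of `P'(α)` (the class and the
function agree almost everywhere). [cite: Burnol2004b, §2 (arXiv:math/0203120v7 p. 4, TeX l.350–355)] -/
theorem rightMellin_toLp_coSum (h : IsTestAway α) (s : ℂ) :
    rightMellin (⇑(h.memLp_two_coSum.toLp (coSum α))) s = rightMellin (coSum α) s := by
  unfold rightMellin mellin
  refine integral_congr_ae ?_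
  filter_upwards [ae_restrict_of_ae (MemLp.coeFn_toLp h.memLp_two_coSum)] with t ht
  rw [ht]

/-- With `∫₀^∞ α(u)du/u = 0`, the entire function `P'(α)^` is a holomorphic continuation to
`ℂ ∖ {1}` of the right Mellin transform of the `L²` class of `P'(α)`.
[cite: Burnol2004b, Prop. 2.2 and §2 eq. (12) (arXiv:math/0203120v7 pp. 4–5, TeX l.341–347, 460–469)] -/
theorem hasRightMellinContinuation_toLp_coSum (h : IsTestAway α)
    (h1 : ∫ u in Ioi (0 : ℝ), α u / (u : ℂ) = 0) :
    HasRightMellinContinuation (⇑(h.memLp_two_coSum.toLp (coSum α))) (rightMellin (coSum α)) :=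
  ⟨(h.differentiable_rightMellin_coSum h1).differentiableOn,
    fun s _ _ ↦ (rightMellin_toLp_coSum h s).symm⟩

/-- **`G_F = ζ·α̂` off `s = 1`** for the `L²` class `F` of `P'(α)` (`∫₀^∞ α(u)du/u = 0`): the
tree's canonical continuation `rightMellinExt F` agrees with `ζ(s)α̂(s)` at every `s ≠ 1`.
[cite: Burnol2004b, §2 eq. (12) and Prop. 2.2 (arXiv:math/0203120v7 pp. 4–5, TeX l.341–347, 460–469)] -/
theorem rightMellinExt_toLp_coSum (h : IsTestAway α) (h1 : ∫ u in Ioi (0 : ℝ), α u / (u : ℂ) = 0)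
    {s : ℂ} (hs : s ≠ 1) :
    rightMellinExt (⇑(h.memLp_two_coSum.toLp (coSum α))) s = riemannZeta s * rightMellin α s := by
  have hG := hasRightMellinContinuation_toLp_coSum h h1
  have hE := hasRightMellinContinuation_rightMellinExt ⟨_, hG⟩
  rw [hE.eqOn hG hs]
  exact h.rightMellin_coSum_eq h1 hs

/-! ## D. The evaluations `M(F)^{(k)}(ρ)` vanish at the non-trivial zeros, `0 ≤ k < m_ρ` -/

/-- `Γ_ℝ` is differentiable away from its poles (where Mathlib's `Γ_ℝ` takes the junk value `0`). [folklore] -/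
private theorem differentiableAt_Gammaℝ_of_ne_zero' {z : ℂ} (hz : Gammaℝ z ≠ 0) :
    DifferentiableAt ℂ Gammaℝ z := by
  have h : ∀ m : ℕ, z / 2 ≠ -m := by
    intro m hm
    apply hz
    rw [Gammaℝ_eq_zero_iff]
    exact ⟨m, by linear_combination 2 * hm⟩
  have h1 : DifferentiableAt ℂ (fun s : ℂ ↦ (π : ℂ) ^ (-s / 2)) z :=
    ((differentiableAt_id.neg.div_const 2).const_cpow (Or.inl (ofReal_ne_zero.2 Real.pi_pos.ne')))
  have h2 : DifferentiableAt ℂ (fun s : ℂ ↦ Complex.Gamma (s / 2)) z :=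
    (Complex.differentiableAt_Gamma _ h).comp z (differentiableAt_id.div_const 2)
  have e : Gammaℝ = fun s ↦ (π : ℂ) ^ (-s / 2) * Complex.Gamma (s / 2) := funext Gammaℝ_def
  rw [e]
  exact h1.mul h2

/-- A non-trivial zero `ρ` of `ζ` is a zero, is `≠ 0, 1`, and is not a pole of `Γ_ℝ`
(`ζ(0) = −1/2`, `ζ(1) ≠ 0`, and the trivial zeros are excluded by definition). [folklore] -/
private theorem nontrivialZero_facts {ρ : ℂ} (hρ : ρ ∈ ZetaZeros.riemannZetaNontrivialZeros) :
    riemannZeta ρ = 0 ∧ ρ ≠ 1 ∧ ρ ≠ 0 ∧ Gammaℝ ρ ≠ 0 := by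
  have hζ : riemannZeta ρ = 0 := hρ.1
  have hρ1 : ρ ≠ 1 := fun h ↦ riemannZeta_one_ne_zero (h ▸ hζ)
  have hρ0 : ρ ≠ 0 := by
    rintro rfl
    rw [riemannZeta_zero] at hζ
    norm_num at hζ
  refine ⟨hζ, hρ1, hρ0, fun hΓ ↦ ?_⟩
  obtain ⟨n, hn⟩ := Gammaℝ_eq_zero_iff.1 hΓ
  cases n with
  | zero => exact hρ0 (by simpa using hn)
  | succ m =>
    exact hρ.2 ⟨m, by rw [hn]; push_cast; ring⟩

/-- **The evaluations vanish at the zeros**: for the `L²` class `F` of `P'(α)` (`∫₀^∞ α(u)du/u = 0`),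
`M(F)^{(k)}(ρ) = (Γ_ℝ·G_F)^{(k)}(ρ) = (ζ·Γ_ℝα̂)^{(k)}(ρ) = 0` for every non-trivial zero `ρ` and
`0 ≤ k < m_ρ` (`ζ` vanishes to order `m_ρ` at `ρ` and `Γ_ℝα̂` is holomorphic there).
[cite: Burnol2004b, §2 (arXiv:math/0203120v7 p. 5, TeX l.472–512), the subspace `W'_a = P_a ∩ K_a`] -/
theorem burnolEval_toLp_coSum_eq_zero (h : IsTestAway α) (h1 : ∫ u in Ioi (0 : ℝ), α u / (u : ℂ) = 0)
    {ρ : ℂ} (hρ : ρ ∈ ZetaZeros.riemannZetaNontrivialZeros) {k : ℕ}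
    (hk : (k : ℤ) < riemannZetaZeroOrder ρ) :
    burnolEval (h.memLp_two_coSum.toLp (coSum α)) ρ k = 0 := by
  obtain ⟨-, hρ1, -, hΓ⟩ := nontrivialZero_facts hρ
  -- near `ρ`, `M(F) = ζ · (Γ_ℝ α̂)`
  have hev : completedMellin (⇑(h.memLp_two_coSum.toLp (coSum α))) =ᶠ[𝓝 ρ]
      fun s ↦ riemannZeta s * (Gammaℝ s * rightMellin α s) := by
    filter_upwards [isOpen_ne.mem_nhds hρ1] with s hs
    unfold completedMellin
    rw [rightMellinExt_toLp_coSum h h1 hs]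
    ring
  unfold burnolEval
  rw [hev.iteratedDeriv_eq]
  -- analyticity at `ρ`
  have hζan : AnalyticAt ℂ riemannZeta ρ := analyticOn_riemannZeta ρ hρ1
  have hhan : AnalyticAt ℂ (fun s ↦ Gammaℝ s * rightMellin α s) ρ := by
    rw [Complex.analyticAt_iff_eventually_differentiableAt]
    have hO : IsOpen {z : ℂ | (Gammaℝ z)⁻¹ ≠ 0} :=
      isOpen_ne_fun differentiable_Gammaℝ_inv.continuous continuous_const
    filter_upwards [hO.mem_nhds (show (Gammaℝ ρ)⁻¹ ≠ 0 from inv_ne_zero hΓ)] with z hz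
    have hz' : Gammaℝ z ≠ 0 := fun h0 ↦ hz (by rw [h0, inv_zero])
    exact (differentiableAt_Gammaℝ_of_ne_zero' hz').mul (h.differentiable_rightMellin z)
  have hprod : AnalyticAt ℂ (fun s ↦ riemannZeta s * (Gammaℝ s * rightMellin α s)) ρ :=
    hζan.fun_mul hhan
  -- the order of `ζ` at `ρ` is `m_ρ`
  by_cases htop : analyticOrderAt riemannZeta ρ = ⊤
  · have h0 : riemannZetaZeroOrder ρ = 0 := by
      rw [riemannZetaZeroOrder, hζan.meromorphicOrderAt_eq, htop]
      simp
    omega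
  · obtain ⟨n, hn⟩ := ENat.ne_top_iff_exists.mp htop
    have hord : riemannZetaZeroOrder ρ = n := by
      rw [riemannZetaZeroOrder, hζan.meromorphicOrderAt_eq, ← hn]
      simp
    have hkn : k < n := by
      rw [hord] at hk
      exact_mod_cast hk
    have hle : (n : ℕ∞) ≤ analyticOrderAt (fun s ↦ riemannZeta s * (Gammaℝ s * rightMellin α s)) ρ := by
      have e : (fun s ↦ riemannZeta s * (Gammaℝ s * rightMellin α s)) =
          riemannZeta * fun s ↦ Gammaℝ s * rightMellin α s := rfl
      rw [e, analyticOrderAt_mul hζan hhan, hn]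
      exact le_self_add
    exact ((natCast_le_analyticOrderAt_iff_iteratedDeriv_eq_zero hprod).1 hle) k hkn

/-! ## E. Orthogonality to the evaluator vectors -/

/-- The conjugate test function has the same vanishing moments. [folklore] -/
private theorem moments_conj (h0 : ∫ u in Ioi (0 : ℝ), α u = 0)
    (h1 : ∫ u in Ioi (0 : ℝ), α u / (u : ℂ) = 0) :
    (∫ u in Ioi (0 : ℝ), conj (α u)) = 0 ∧ (∫ u in Ioi (0 : ℝ), conj (α u) / (u : ℂ)) = 0 := by
  constructor
  · rw [integral_conj, h0, map_zero]
  · have e : (fun u : ℝ ↦ conj (α u) / (u : ℂ)) = fun u ↦ conj (α u / (u : ℂ)) := by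
      funext u; rw [map_div₀, Complex.conj_ofReal]
    rw [e, integral_conj, h1, map_zero]

/-- **`⟪F, Z⟫ = 2∫₀^∞ conj(P'(α))·Z = 2[P'(ᾱ), Z]`** for the `L²` class `F` of `P'(α)` and an even
class `Z`: the Hermitian product of `L²(ℝ)` against Burnol's bilinear form `[f,g] = ∫₀^∞ fg` on even
functions. [cite: Burnol2004b, §3 (arXiv:math/0203120v7 p. 6, TeX l.558–560), "we use rather the bilinear form `[f,g] = ∫₀^∞ f(t)g(t)dt`"] -/
theorem inner_toLp_coSum_eq_two_mul (h : IsTestAway α) {Z : Lp ℂ 2 (volume : Measure ℝ)}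
    (hZ : Z ∈ evenL2) :
    inner ℂ (h.memLp_two_coSum.toLp (coSum α)) Z =
      2 * ∫ t in Ioi (0 : ℝ),
        (h.comp_conj.memLp_two_coSum.toLp (coSum fun u ↦ conj (α u)) : ℝ → ℂ) t * Z t := by
  set F : Lp ℂ 2 (volume : Measure ℝ) := h.memLp_two_coSum.toLp (coSum α) with hF
  set Fc : Lp ℂ 2 (volume : Measure ℝ) :=
    h.comp_conj.memLp_two_coSum.toLp (coSum fun u ↦ conj (α u)) with hFc
  have haeF : ⇑F =ᵐ[volume] coSum α := MemLp.coeFn_toLp _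
  have haeFc : ⇑Fc =ᵐ[volume] coSum (fun u ↦ conj (α u)) := MemLp.coeFn_toLp _
  -- `⟪F, Z⟫ = ∫ Fc · Z`
  have hint : Integrable (fun t : ℝ ↦ Fc t * Z t) := (Lp.memLp Fc).integrable_mul (Lp.memLp Z)
  have e1 : inner ℂ F Z = ∫ t : ℝ, Fc t * Z t := by
    rw [MeasureTheory.L2.inner_def]
    refine integral_congr_ae ?_
    filter_upwards [haeF, haeFc] with t htF htFc
    rw [RCLike.inner_apply, htF, htFc, coSum_conj, mul_comm]
  -- evenness
  have heven : ∀ᵐ t : ℝ, Fc (-t) * Z (-t) = Fc t * Z t := by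
    have haeFc' : ∀ᵐ t : ℝ, Fc (-t) = coSum (fun u ↦ conj (α u)) (-t) :=
      (Measure.measurePreserving_neg (volume : Measure ℝ)).quasiMeasurePreserving.ae haeFc
    filter_upwards [haeFc, haeFc', hZ] with t ht ht' hZt
    rw [ht', ht, hZt, coSum_neg h.comp_conj.even]
  rw [e1, integral_eq_two_mul_setIntegral_Ioi_of_ae_even hint heven]

/-- **Orthogonality to the evaluators of `K_a`**: if `supp α ⊂ [a, 1/a]` (as a subset of `(0,∞)`),
`∫₀^∞ α = 0 = ∫₀^∞ α(u)du/u`, and `Z ∈ K_a` represents `f ↦ M(f)^{(k)}(ρ)` on `K_a` for a non-trivial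
zero `ρ` and `k < m_ρ`, then the `L²` class `F ∈ K_a` of `P'(α)` satisfies `⟪F, Z⟫ = 0` — indeed
`⟪F, Z⟫ = 2[P'(ᾱ), Z] = 2M(P'(ᾱ))^{(k)}(ρ) = 0`.
[cite: Burnol2004b, §2 (arXiv:math/0203120v7 p. 5, TeX l.481–512), `W'_a = P_a ∩ K_a` and the evaluators `Z^a_{ρ,k}`] -/
theorem inner_toLp_coSum_eq_zero_of_isBurnolZ {a : ℝ} (ha : 0 < a) (h : IsTestAway α)
    (hz : ∀ y, |y| < a → α y = 0) (hz' : ∀ y, a⁻¹ < |y| → α y = 0)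
    (h0 : ∫ u in Ioi (0 : ℝ), α u = 0) (h1 : ∫ u in Ioi (0 : ℝ), α u / (u : ℂ) = 0)
    {ρ : ℂ} (hρ : ρ ∈ ZetaZeros.riemannZetaNontrivialZeros) {k : ℕ}
    (hk : (k : ℤ) < riemannZetaZeroOrder ρ) {Z : Lp ℂ 2 (volume : Measure ℝ)}
    (hZ : IsBurnolZ a ρ k Z) :
    inner ℂ (h.memLp_two_coSum.toLp (coSum α)) Z = 0 := by
  obtain ⟨h0c, h1c⟩ := moments_conj h0 h1
  have hc := h.comp_conj
  have hmem : hc.memLp_two_coSum.toLp (coSum fun u ↦ conj (α u)) ∈ sonineK a :=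
    hc.toLp_coSum_mem_sonineK ha (fun y hy ↦ by simp [hz y hy]) (fun y hy ↦ by simp [hz' y hy]) h0c h1c
  rw [inner_toLp_coSum_eq_two_mul h hZ.1.1, hZ.2 _ hmem, burnolEval_toLp_coSum_eq_zero hc h1c hρ hk,
    mul_zero]

/-- **Orthogonality to the evaluators of `L_a`** (same hypotheses, `Y ∈ L_a` representing
`f ↦ M(f)^{(k)}(ρ)` on `L_a`; `F ∈ K_a ⊂ L_a`).
[cite: Burnol2004b, Prop. 6.4 proof (arXiv:math/0203120v7 p. 16, TeX l.1287–1291), "not complete from the existence of the co-Poisson subspace"] -/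
theorem inner_toLp_coSum_eq_zero_of_isBurnolY {a : ℝ} (ha : 0 < a) (h : IsTestAway α)
    (hz : ∀ y, |y| < a → α y = 0) (hz' : ∀ y, a⁻¹ < |y| → α y = 0)
    (h0 : ∫ u in Ioi (0 : ℝ), α u = 0) (h1 : ∫ u in Ioi (0 : ℝ), α u / (u : ℂ) = 0)
    {ρ : ℂ} (hρ : ρ ∈ ZetaZeros.riemannZetaNontrivialZeros) {k : ℕ}
    (hk : (k : ℤ) < riemannZetaZeroOrder ρ) {Y : Lp ℂ 2 (volume : Measure ℝ)}
    (hY : IsBurnolY a ρ k Y) :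
    inner ℂ (h.memLp_two_coSum.toLp (coSum α)) Y = 0 := by
  obtain ⟨h0c, h1c⟩ := moments_conj h0 h1
  have hc := h.comp_conj
  have hmem : hc.memLp_two_coSum.toLp (coSum fun u ↦ conj (α u)) ∈ sonineL a :=
    sonineK_subset_sonineL a
      (hc.toLp_coSum_mem_sonineK ha (fun y hy ↦ by simp [hz y hy]) (fun y hy ↦ by simp [hz' y hy])
        h0c h1c)
  rw [inner_toLp_coSum_eq_two_mul h hY.1.1, hY.2 _ hmem, burnolEval_toLp_coSum_eq_zero hc h1c hρ hk,
    mul_zero]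

end SonineVector

/-! ## F. Test functions with two vanishing moments; non-completeness -/

section Examples

/-- Integrability of `u ↦ φ(u)/u` for a compactly supported continuous `φ` vanishing on
`(−a, a)`, `a > 0`. [folklore] -/
private theorem integrable_div_of_vanish' {φ : ℝ → ℝ} (hφc : Continuous φ) (hφs : HasCompactSupport φ)
    {a : ℝ} (ha : 0 < a) (hz : ∀ u, |u| < a → φ u = 0) :
    Integrable fun u : ℝ ↦ φ u / u := by
  have hint : Integrable φ := hφc.integrable_of_hasCompactSupport hφs
  refine (hint.norm.mul_const a⁻¹).mono' (hφc.measurable.mul measurable_inv).aestronglyMeasurable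
    (Eventually.of_forall fun u ↦ ?_)
  by_cases hu : |u| < a
  · simp [hz u hu]
  · rw [not_lt] at hu
    rw [norm_div, Real.norm_eq_abs, Real.norm_eq_abs, div_eq_mul_inv]
    exact mul_le_mul_of_nonneg_left (inv_anti₀ ha hu) (abs_nonneg _)

/-- **Test functions with two vanishing moments** ([Burnol2004, §6 opening, TeX l.2199–2201]: "`α(t)`
smooth with support in `[λ,Λ]` and such that `∫₀^∞ α(t)dt = 0 = ∫₀^∞ (α(1/t)/t)dt`"): for `0 < a < b`
there is a smooth even `α`, supported in `a ≤ |y| ≤ b`, with `∫₀^∞ α = 0 = ∫₀^∞ α(u)du/u` and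
`α(y₀) ≠ 0` at some `y₀ ∈ (a,b)` — three disjoint bumps in `(a,b)` combined with the cross product of
their moment vectors (the same construction as the private `exists_testAway_moments` of
`BurnolFourierZetaSonine.lean`, re-derived here because that lemma is not exported).
[cite: Burnol2004, §6 (TeX l.2190–2203)] -/
theorem exists_testAway_two_moments {a b : ℝ} (ha : 0 < a) (hab : a < b) :
    ∃ α : ℝ → ℂ, IsTestAway α ∧ (∀ y, |y| < a → α y = 0) ∧ (∀ y, b < |y| → α y = 0) ∧
      (∫ u in Ioi (0 : ℝ), α u = 0) ∧ (∫ u in Ioi (0 : ℝ), α u / (u : ℂ) = 0) ∧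
      ∃ y₀ : ℝ, a < y₀ ∧ y₀ < b ∧ α y₀ ≠ 0 := by
  -- geometry of the three bumps
  set d : ℝ := b - a with hd
  have hd0 : 0 < d := by rw [hd]; linarith
  set r : ℝ := d / 10 with hr
  have hr0 : 0 < r := by positivity
  set c : Fin 3 → ℝ := ![a + d / 4, a + d / 2, a + 3 * d / 4] with hc
  have hc0 : c 0 = a + d / 4 := rfl
  have hc1 : c 1 = a + d / 2 := rfl
  have hc2 : c 2 = a + 3 * d / 4 := rfl
  have hcin : ∀ i : Fin 3, a + r < c i ∧ c i + r < b := by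
    intro i; fin_cases i <;> simp only [hc0, hc1, hc2, Fin.zero_eta, Fin.mk_one, Fin.reduceFinMk] <;>
      constructor <;> linarith
  set φ : ∀ i : Fin 3, ContDiffBump (c i) := fun i ↦ ⟨r / 2, r, by positivity, by linarith⟩ with hφ
  have hφr : ∀ i, (φ i).rOut = r := fun i ↦ rfl
  have hφrIn : ∀ i, (φ i).rIn = r / 2 := fun i ↦ rfl
  -- vanishing of the bumps outside `(a, b)` and at the other centres
  have hφzero : ∀ (i : Fin 3) (u : ℝ), r ≤ |u - c i| → φ i u = 0 := by
    intro i u hu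
    exact (φ i).zero_of_le_dist (by rw [hφr, Real.dist_eq]; exact hu)
  have hφzero_small : ∀ (i : Fin 3) (u : ℝ), u ≤ a → φ i u = 0 := by
    intro i u hu
    refine hφzero i u ?_
    have := (hcin i).1
    rw [abs_sub_comm, abs_of_pos (by linarith)]; linarith
  have hφzero_large : ∀ (i : Fin 3) (u : ℝ), b ≤ u → φ i u = 0 := by
    intro i u hu
    refine hφzero i u ?_
    have := (hcin i).2
    rw [abs_of_pos (by linarith)]; linarith
  -- the moments
  have hφint : ∀ i, Integrable (fun u : ℝ ↦ φ i u) :=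
    fun i ↦ (φ i).continuous.integrable_of_hasCompactSupport (φ i).hasCompactSupport
  have hφint' : ∀ i, Integrable (fun u : ℝ ↦ φ i u / u) := fun i ↦
    integrable_div_of_vanish' (φ i).continuous (φ i).hasCompactSupport ha
      (fun u hu ↦ hφzero_small i u (le_of_lt (lt_of_le_of_lt (le_abs_self u) hu)))
  set m : Fin 3 → ℝ := fun i ↦ ∫ u in Ioi (0 : ℝ), φ i u with hm
  set n : Fin 3 → ℝ := fun i ↦ ∫ u in Ioi (0 : ℝ), φ i u / u with hn
  have hm_eq : ∀ i, m i = ∫ u : ℝ, φ i u := by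
    intro i
    exact setIntegral_eq_integral_of_forall_compl_eq_zero fun u hu ↦
      hφzero_small i u (le_of_lt (lt_of_le_of_lt (not_lt.1 hu) ha))
  have hm_pos : ∀ i, 0 < m i := fun i ↦ by rw [hm_eq]; exact (φ i).integral_pos
  -- `n 0 ≥ m 0/(c 0 + r)` and `n 1 ≤ m 1/(c 1 - r)`
  have hc0r : 0 < c 0 + r := by have := (hcin 0).1; linarith
  have hc1r : 0 < c 1 - r := by have := (hcin 1).1; linarith
  have hn0 : m 0 / (c 0 + r) ≤ n 0 := by
    rw [hm, hn]; dsimp only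
    rw [← integral_div]
    refine setIntegral_mono_on ((hφint 0).div_const _).integrableOn (hφint' 0).integrableOn
      measurableSet_Ioi fun u hu ↦ ?_
    have hu0 : (0 : ℝ) < u := hu
    by_cases hφu : φ 0 u = 0
    · simp [hφu]
    · have hle : u ≤ c 0 + r := by
        by_contra hlt
        exact hφu (hφzero 0 u (by rw [abs_of_pos (by linarith [not_le.1 hlt])]; linarith [not_le.1 hlt]))
      exact div_le_div_of_nonneg_left (φ 0).nonneg hu0 hle
  have hn1 : n 1 ≤ m 1 / (c 1 - r) := by
    rw [hm, hn]; dsimp only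
    rw [← integral_div]
    refine setIntegral_mono_on (hφint' 1).integrableOn ((hφint 1).div_const _).integrableOn
      measurableSet_Ioi fun u hu ↦ ?_
    have hu0 : (0 : ℝ) < u := hu
    by_cases hφu : φ 1 u = 0
    · simp [hφu]
    · have hle : c 1 - r ≤ u := by
        by_contra hlt
        exact hφu (hφzero 1 u (by rw [abs_sub_comm, abs_of_pos (by linarith [not_le.1 hlt])]; linarith [not_le.1 hlt]))
      exact div_le_div_of_nonneg_left (φ 1).nonneg hc1r hle
  -- the coefficients: cross product of `m` and `n`
  set l : Fin 3 → ℝ := ![m 1 * n 2 - m 2 * n 1, m 2 * n 0 - m 0 * n 2, m 0 * n 1 - m 1 * n 0]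
    with hl
  have hl0 : l 0 = m 1 * n 2 - m 2 * n 1 := rfl
  have hl1 : l 1 = m 2 * n 0 - m 0 * n 2 := rfl
  have hl2 : l 2 = m 0 * n 1 - m 1 * n 0 := rfl
  have hsum_m : l 0 * m 0 + l 1 * m 1 + l 2 * m 2 = 0 := by rw [hl0, hl1, hl2]; ring
  have hsum_n : l 0 * n 0 + l 1 * n 1 + l 2 * n 2 = 0 := by rw [hl0, hl1, hl2]; ring
  have hl2_neg : l 2 < 0 := by
    rw [hl2, sub_neg]
    have hsep : c 0 + r < c 1 - r := by rw [hc0, hc1, hr]; linarith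
    calc m 0 * n 1 ≤ m 0 * (m 1 / (c 1 - r)) := by gcongr; exact (hm_pos 0).le
      _ = m 0 * m 1 / (c 1 - r) := by ring
      _ < m 0 * m 1 / (c 0 + r) := by
          apply div_lt_div_of_pos_left (mul_pos (hm_pos 0) (hm_pos 1)) hc0r hsep
      _ = m 1 * (m 0 / (c 0 + r)) := by ring
      _ ≤ m 1 * n 0 := by gcongr; exact (hm_pos 1).le
  -- the function
  set α₀ : ℝ → ℝ := fun u ↦ l 0 * φ 0 u + l 1 * φ 1 u + l 2 * φ 2 u with hα₀
  have hα₀_smooth : ContDiff ℝ ((⊤ : ℕ∞) : WithTop ℕ∞) α₀ :=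
    ((contDiff_const.mul (φ 0).contDiff).add (contDiff_const.mul (φ 1).contDiff)).add
      (contDiff_const.mul (φ 2).contDiff)
  have hα₀_small : ∀ u, u ≤ a → α₀ u = 0 := by
    intro u hu; simp [hα₀, hφzero_small _ u hu]
  have hα₀_large : ∀ u, b ≤ u → α₀ u = 0 := by
    intro u hu; simp [hα₀, hφzero_large _ u hu]
  set α : ℝ → ℂ := fun y ↦ ((α₀ y + α₀ (-y) : ℝ) : ℂ) with hα
  have hα_pos : ∀ u, 0 < u → α u = (α₀ u : ℂ) := by
    intro u hu
    rw [hα]; dsimp only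
    rw [hα₀_small (-u) (by linarith), add_zero]
  have hz : ∀ y, |y| < a → α y = 0 := by
    intro y hy
    rw [abs_lt] at hy
    rw [hα]; dsimp only
    rw [hα₀_small y hy.2.le, hα₀_small (-y) (by linarith), add_zero, Complex.ofReal_zero]
  have hz' : ∀ y, b < |y| → α y = 0 := by
    intro y hy
    rw [hα]; dsimp only
    rcases lt_abs.1 hy with h | h
    · rw [hα₀_large y h.le, hα₀_small (-y) (by linarith), add_zero, Complex.ofReal_zero]
    · rw [hα₀_small y (by linarith), hα₀_large (-y) h.le, add_zero, Complex.ofReal_zero]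
  refine ⟨α, ⟨?_, ?_, ?_, ?_⟩, hz, hz', ?_, ?_, ⟨c 2, (by have := (hcin 2).1; linarith),
    (by have := (hcin 2).2; linarith), ?_⟩⟩
  · -- smooth
    exact Complex.ofRealCLM.contDiff.comp (hα₀_smooth.add (hα₀_smooth.comp contDiff_neg))
  · -- even
    intro y; rw [hα]; dsimp only; rw [neg_neg, add_comm]
  · -- compact support
    refine HasCompactSupport.of_support_subset_isCompact (isCompact_Icc (a := -b) (b := b)) ?_
    intro y hy
    by_contra hyI
    apply hy
    apply hz'
    rw [mem_Icc, not_and_or, not_le, not_le] at hyI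
    rcases hyI with h | h
    · rw [abs_of_neg (by linarith)]; linarith
    · rw [abs_of_pos (by linarith)]; exact h
  · -- away from the origin
    intro hmem
    have : α =ᶠ[𝓝 (0 : ℝ)] 0 := by
      filter_upwards [Metric.ball_mem_nhds (0 : ℝ) ha] with y hy
      exact hz y (by simpa using hy)
    exact (notMem_tsupport_iff_eventuallyEq.2 this) hmem
  · -- `∫₀^∞ α = 0`
    have e : ∫ u in Ioi (0 : ℝ), α u = ∫ u in Ioi (0 : ℝ), ((α₀ u : ℝ) : ℂ) :=
      setIntegral_congr_fun measurableSet_Ioi fun u hu ↦ hα_pos u hu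
    rw [e, integral_complex_ofReal]
    have : ∫ u in Ioi (0 : ℝ), α₀ u = l 0 * m 0 + l 1 * m 1 + l 2 * m 2 := by
      rw [hα₀]; dsimp only
      rw [integral_add, integral_add, integral_const_mul, integral_const_mul, integral_const_mul]
      · exact ((hφint 0).const_mul _).integrableOn
      · exact ((hφint 1).const_mul _).integrableOn
      · exact (((hφint 0).const_mul _).add ((hφint 1).const_mul _)).integrableOn
      · exact ((hφint 2).const_mul _).integrableOn
    rw [this, hsum_m, Complex.ofReal_zero]
  · -- `∫₀^∞ α(u)du/u = 0`
    have e : ∫ u in Ioi (0 : ℝ), α u / (u : ℂ) = ∫ u in Ioi (0 : ℝ), ((α₀ u / u : ℝ) : ℂ) :=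
      setIntegral_congr_fun measurableSet_Ioi fun u hu ↦ by
        rw [hα_pos u hu]; push_cast; rfl
    rw [e, integral_complex_ofReal]
    have : ∫ u in Ioi (0 : ℝ), α₀ u / u = l 0 * n 0 + l 1 * n 1 + l 2 * n 2 := by
      have e2 : (fun u : ℝ ↦ α₀ u / u) =
          fun u ↦ l 0 * (φ 0 u / u) + l 1 * (φ 1 u / u) + l 2 * (φ 2 u / u) := by
        funext u; rw [hα₀]; dsimp only; ring
      rw [e2, integral_add, integral_add, integral_const_mul, integral_const_mul, integral_const_mul]
      · exact ((hφint' 0).const_mul _).integrableOn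
      · exact ((hφint' 1).const_mul _).integrableOn
      · exact (((hφint' 0).const_mul _).add ((hφint' 1).const_mul _)).integrableOn
      · exact ((hφint' 2).const_mul _).integrableOn
    rw [this, hsum_n, Complex.ofReal_zero]
  · -- `α(c 2) = l 2 ≠ 0`
    have hc2pos : 0 < c 2 := by have := (hcin 2).1; linarith
    rw [hα_pos _ hc2pos, Complex.ofReal_ne_zero, hα₀]
    dsimp only
    have h0 : φ 0 (c 2) = 0 := hφzero 0 _ (by rw [hc0, hc2, hr, abs_of_pos (by linarith)]; linarith)
    have h1 : φ 1 (c 2) = 0 := hφzero 1 _ (by rw [hc1, hc2, hr, abs_of_pos (by linarith)]; linarith)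
    have h2 : φ 2 (c 2) = 1 :=
      (φ 2).one_of_mem_closedBall (by rw [Metric.mem_closedBall, dist_self, hφrIn]; positivity)
    rw [h0, h1, h2]
    linarith

/-- **The co-Poisson Sonine vector `F ∈ W'_a = P_a ∩ K_a`** (`0 < a < 1`): a non-zero element of
`K_a`, lying in the co-Poisson subspace `P_a`, orthogonal to every vector representing an evaluation
`f ↦ M(f)^{(k)}(ρ)` (`ρ` a non-trivial zero, `0 ≤ k < m_ρ`) on `K_a` or on `L_a`.
[cite: Burnol2004b, §2 (arXiv:math/0203120v7 p. 5, TeX l.493–512), `W'_a = P_a ∩ K_a`; Prop. 6.4 proof (p. 16, TeX l.1287–1291)] -/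
theorem exists_mem_sonineK_inter_coPoissonP_orthogonal {a : ℝ} (ha : 0 < a) (ha1 : a < 1) :
    ∃ F : Lp ℂ 2 (volume : Measure ℝ), F ∈ sonineK a ∧ F ∈ coPoissonP a ∧ F ≠ 0 ∧
      (∀ ρ ∈ ZetaZeros.riemannZetaNontrivialZeros, ∀ k : ℕ, (k : ℤ) < riemannZetaZeroOrder ρ →
        ∀ Z : Lp ℂ 2 (volume : Measure ℝ), IsBurnolZ a ρ k Z → inner ℂ F Z = 0) ∧
      (∀ ρ ∈ ZetaZeros.riemannZetaNontrivialZeros, ∀ k : ℕ, (k : ℤ) < riemannZetaZeroOrder ρ →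
        ∀ Y : Lp ℂ 2 (volume : Measure ℝ), IsBurnolY a ρ k Y → inner ℂ F Y = 0) := by
  set b : ℝ := min (2 * a) a⁻¹ with hb
  have hab : a < b := by
    rw [hb, lt_min_iff]; constructor
    · linarith
    · exact ha1.trans ((one_lt_inv₀ ha).2 ha1)
  obtain ⟨α, hα, hz, hz', h0, h1, y₀, hy₀a, hy₀b, hy₀⟩ := exists_testAway_two_moments ha hab
  have hzb : ∀ y, a⁻¹ < |y| → α y = 0 := fun y hy ↦ hz' y (lt_of_le_of_lt (min_le_right _ _) hy)
  refine ⟨hα.memLp_two_coSum.toLp (coSum α), hα.toLp_coSum_mem_sonineK ha hz hzb h0 h1,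
    hα.toLp_coSum_mem_coPoissonP (fun t ht hnot ↦ ?_), hα.toLp_coSum_ne_zero (y₀ := y₀) ?_,
    fun ρ hρ k hk Z hZ ↦ inner_toLp_coSum_eq_zero_of_isBurnolZ ha hα hz hzb h0 h1 hρ hk hZ,
    fun ρ hρ k hk Y hY ↦ inner_toLp_coSum_eq_zero_of_isBurnolY ha hα hz hzb h0 h1 hρ hk hY⟩
  · -- vanishing off `(a, 1/a)` on `(0,∞)`
    rw [mem_Ioo, not_and_or, not_lt, not_lt] at hnot
    rcases hnot with hle | hle
    · rcases hle.lt_or_eq with hlt | heq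
      · exact hz t (by rw [abs_of_pos ht]; exact hlt)
      · -- `t = a`: `α` is continuous and vanishes on `(0,a)`
        have hcont : ContinuousAt α t := hα.contDiff.continuous.continuousAt
        have hlim : Tendsto α (𝓝[<] t) (𝓝 0) := by
          apply tendsto_const_nhds.congr'
          filter_upwards [Ioo_mem_nhdsLT ht] with y hy
          exact (hz y (by rw [abs_of_pos hy.1, ← heq]; exact hy.2)).symm
        exact tendsto_nhds_unique (hcont.tendsto.mono_left nhdsWithin_le_nhds) hlim
    · rcases hle.lt_or_eq with hlt | heq
      · exact hzb t (by rw [abs_of_pos ht]; exact hlt)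
      · have hcont : ContinuousAt α t := hα.contDiff.continuous.continuousAt
        have hlim : Tendsto α (𝓝[>] t) (𝓝 0) := by
          apply tendsto_const_nhds.congr'
          filter_upwards [self_mem_nhdsWithin] with y (hy : t < y)
          exact (hzb y (by rw [abs_of_pos (ht.trans hy), heq]; exact hy)).symm
        exact tendsto_nhds_unique (hcont.tendsto.mono_left nhdsWithin_le_nhds) hlim
  · -- `P'(α)(y₀) = α(y₀) ≠ 0`
    have hy2 : |y₀| < 2 * a := by
      rw [abs_of_pos (ha.trans hy₀a)]
      exact hy₀b.trans_le (min_le_left _ _)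
    rw [coSum_eq_sub_of_abs_lt hz hy2, h1, sub_zero]
    exact hy₀

/-- A vector of `S` orthogonal to every member of a system whose closed span contains `S` is zero;
contrapositively, a non-zero such vector shows the system is not complete in `S`. [folklore] -/
private theorem not_subset_closure_span_of_inner_eq_zero {E : Type*} [NormedAddCommGroup E]
    [InnerProductSpace ℂ E] {ι : Type*} {u : ι → E} {S : Set E} {F : E} (hFS : F ∈ S)
    (hF0 : F ≠ 0) (horth : ∀ i, inner ℂ F (u i) = 0) :
    ¬ S ⊆ closure (Submodule.span ℂ (Set.range u) : Set E) := by
  intro hsub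
  set K : Submodule ℂ E := LinearMap.ker ((innerSL ℂ F : E →L[ℂ] ℂ) : E →ₗ[ℂ] ℂ) with hK
  have hKc : IsClosed (K : Set E) := (innerSL ℂ F).isClosed_ker
  have hspan : Submodule.span ℂ (Set.range u) ≤ K := by
    rw [Submodule.span_le]
    rintro _ ⟨i, rfl⟩
    simp [hK, horth i]
  have hcl : closure (Submodule.span ℂ (Set.range u) : Set E) ⊆ K :=
    (closure_mono hspan).trans hKc.closure_subset
  have hF : F ∈ K := hcl (hsub hFS)
  have : inner ℂ F F = 0 := by simpa [hK] using hF
  exact hF0 (inner_self_eq_zero.1 this)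

/-- **Thm. 3.2, the non-completeness clause, for any system of representing vectors** ("The vectors
`Z^a_{ρ,k}`, `0 ≤ k < m_ρ`, are a minimal, but not complete, system for `a < 1`", TeX l.528–530): for
`0 < a < 1`, no system `Z : (ρ,k) ↦ Z^a_{ρ,k}` of vectors of `K_a` representing the evaluations
`f ↦ M(f)^{(k)}(ρ)` on `K_a` (`0 ≤ k < m_ρ`) is complete in `K_a` — the co-Poisson Sonine vector
`F ∈ W'_a` is non-zero and orthogonal to all of them. This is the inline hypothesis `hnc` of
`Burnol2004b_thm3_2_of`, up to the existence of representing vectors for the tree's `burnolZSystem a`.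
[cite: Burnol2004b, Thm. 3.2 (arXiv:math/0203120v7 p. 6, TeX l.528–530) and §2 (p. 5, TeX l.500–512)] -/
theorem not_isCompleteSystemIn_sonineK_of_isBurnolZ {a : ℝ} (ha : 0 < a) (ha1 : a < 1)
    {Z : ZetaZeroIndex → Lp ℂ 2 (volume : Measure ℝ)}
    (hZ : ∀ p : ZetaZeroIndex, IsBurnolZ a p.1.1 p.1.2 (Z p)) :
    ¬ IsCompleteSystemIn (sonineK a) Z := by
  obtain ⟨F, hFK, -, hF0, hZorth, -⟩ := exists_mem_sonineK_inter_coPoissonP_orthogonal ha ha1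
  intro hc
  exact not_subset_closure_span_of_inner_eq_zero hFK hF0
    (fun p ↦ hZorth p.1.1 p.2.1 p.1.2 p.2.2 (Z p) (hZ p)) hc.2

/-- **Prop. 6.4, the non-completeness clause, for any system of representing vectors** ("Let `a < 1`.
The vectors `Y^a_{ρ,k}` are minimal and not complete in `L_a`. … they are not complete from the
existence of the co-Poisson subspace `P_a`", TeX l.1282–1291): for `0 < a < 1`, no system
`Y : (ρ,k) ↦ Y^a_{ρ,k}` of vectors of `L_a` representing the evaluations on `L_a` is complete in `L_a`.
[cite: Burnol2004b, Prop. 6.4 (arXiv:math/0203120v7 p. 16, TeX l.1282–1291)] -/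
theorem not_isCompleteSystemIn_sonineL_of_isBurnolY {a : ℝ} (ha : 0 < a) (ha1 : a < 1)
    {Y : ZetaZeroIndex → Lp ℂ 2 (volume : Measure ℝ)}
    (hY : ∀ p : ZetaZeroIndex, IsBurnolY a p.1.1 p.1.2 (Y p)) :
    ¬ IsCompleteSystemIn (sonineL a) Y := by
  obtain ⟨F, hFK, -, hF0, -, hYorth⟩ := exists_mem_sonineK_inter_coPoissonP_orthogonal ha ha1
  intro hc
  exact not_subset_closure_span_of_inner_eq_zero (sonineK_subset_sonineL a hFK) hF0
    (fun p ↦ hYorth p.1.1 p.2.1 p.1.2 p.2.2 (Y p) (hY p)) hc.2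

end Examples

/-! ## G. The tree's systems `burnolZSystem a`, `burnolYSystem a`; Thm. 3.2 / Prop. 6.4 bookkeeping -/

section TreeSystems

/-- **Thm. 3.2, non-completeness clause, for the tree's system `(Z^a_{ρ,k})`**: for `0 < a < 1` the
vectors `burnolZSystem a` are not complete in `K_a`. This is literally the hypothesis `hnc` of
`Burnol2004b_thm3_2_of`. [cite: Burnol2004b, Thm. 3.2 (arXiv:math/0203120v7 p. 6, TeX l.528–530)] -/
theorem not_isCompleteSystemIn_sonineK_burnolZSystem {a : ℝ} (ha : 0 < a) (ha1 : a < 1) :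
    ¬ IsCompleteSystemIn (sonineK a) (burnolZSystem a) :=
  not_isCompleteSystemIn_sonineK_of_isBurnolZ ha ha1 (BurnolEvaluators.isBurnolZ_burnolZSystem ha)

/-- **Prop. 6.4, non-completeness clause, for the tree's system `(Y^a_{ρ,k})`**: for `0 < a < 1` the
vectors `burnolYSystem a` are not complete in `L_a`.
[cite: Burnol2004b, Prop. 6.4 (arXiv:math/0203120v7 p. 16, TeX l.1282–1291)] -/
theorem not_isCompleteSystemIn_sonineL_burnolYSystem {a : ℝ} (ha : 0 < a) (ha1 : a < 1) :
    ¬ IsCompleteSystemIn (sonineL a) (burnolYSystem a) :=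
  not_isCompleteSystemIn_sonineL_of_isBurnolY ha ha1
    (BurnolEvaluators.isBurnolY_burnolYSystem (a := a) ha)

/-- **Thm. 3.2 assembled from its §6 constituents alone** (Thm. 6.7, Props. 6.5, 6.6): the tree's
`Burnol2004b_thm3_2_of` with its non-completeness binder discharged by
`not_isCompleteSystemIn_sonineK_burnolZSystem`.
[cite: Burnol2004b, §6 (arXiv:math/0203120v7 pp. 16–17, TeX l.1303–1378), "The three theorems 3.1, 3.2, 3.3 are thus established"] -/
theorem Burnol2004b_thm3_2_of_constituents (h67 : Burnol2004b_thm6_7) (h65 : Burnol2004b_prop6_5)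
    (h66 : Burnol2004b_prop6_6) : Burnol2004b_thm3_2 :=
  Burnol2004b_thm3_2_of h67 (fun _ ha ha1 ↦ not_isCompleteSystemIn_sonineK_burnolZSystem ha ha1)
    h65 h66

/-- **Prop. 6.4 reduced to its minimality half**: with non-completeness proved, Prop. 6.4 follows
from "for `a < 1` the `Y^a_{ρ,k}` are minimal" (whose printed proof — "their orthogonal projections to
`L_1` are the `Y¹_{ρ,k}`", minimal by Thm. 6.3 — rests on the §6 Kreĭn-type results, not formalised).
[cite: Burnol2004b, Prop. 6.4 (arXiv:math/0203120v7 p. 16, TeX l.1282–1291)] -/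
theorem Burnol2004b_prop6_4_of_minimal
    (hmin : ∀ a : ℝ, 0 < a → a < 1 → IsMinimalSystem (burnolYSystem a)) : Burnol2004b_prop6_4 :=
  fun a ha ha1 ↦ ⟨hmin a ha ha1, not_isCompleteSystemIn_sonineL_burnolYSystem ha ha1⟩

/-- **Prop. 6.4 (discharge).** "Let `a < 1`. The vectors `Y^a_{ρ,k}` are minimal and not complete in
`L_a`." Minimality is the tree's `BurnolEvaluatorsMinimal.Burnol2004b_prop6_4_minimal` (the dual
functionals `[ζ(s)/(s−ρ)^l, ·]` of Thm. 6.3 restricted along `L_1 ⊆ L_a` — the printed "their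
orthogonal projections to `L_1` … are the vectors `Y¹_{ρ,k}`"); non-completeness is
`not_isCompleteSystemIn_sonineL_burnolYSystem` ("from the existence of the co-Poisson subspace `P_a`").
Discharges `Literature.NumberTheory.LFunctions.Burnol2004b_prop6_4`.
[cite: Burnol2004b, Prop. 6.4 (arXiv:math/0203120v7 p. 16, TeX l.1282–1291)] -/
theorem Burnol2004b_prop6_4_holds : Burnol2004b_prop6_4 :=
  Burnol2004b_prop6_4_of_minimal BurnolEvaluatorsMinimal.Burnol2004b_prop6_4_minimal

end TreeSystems

end Literature.NumberTheory.LFunctions
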